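import Summits.QuantumFields.QCD.Theorems.QuarksAsStableActionCriticalLineDiamagnetismCellFreeKron

/-!
# Finite Neumann expansion of the free propagator and planar identification of short torus walks (B6 infrastructure, 4/4)

Crux `Summit.QuantumFields.QCD.Theses.QuarksAsStableAction.CriticalLineDiamagnetism` (item stmt-QuantumFields-9734,
sub-problem `Summits/QuantumFields/QCD/Statement.lean`), line `Sketch`, Route B step B6: infrastructure for the registered
cell sub-stub `cellFirstOrder` of `stub_heavyFrequencyGain` (plan `S4-PLAN.md` §B6 of the line lead; vocabulary
`CellFO.*` of `…CellFirstOrderDefs`).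

`G = Σ_{j<J} K^j N⁻¹ + K^J G` with `K = N⁻¹ hopOp`; the spin block of `K^j N⁻¹` between the origin and a site at planar
position `(u,v)` with `|u| + |v| + j ≤ R`, `R + 1 < L₁, L₂`, equals the planar walk sum `CellKappa.planarWalk` up to a gauge
sign (the walks do not wrap; the antiperiodic seams are gauged to the half-lines `u < 0`, `v < 0`).  Consequently the
reference link block `G((1,0),(0,0))` is within `(2/M)^15/(M−2) ≤ 2.5·10⁻⁷` of
`CellKappa.propTrunc M (sin ω₀) (sin ω₁) 14 (1,0)` on the heavy box `M_ω ≥ 5.89` for torus lengths `≥ 17`.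
-/

noncomputable section

open scoped BigOperators Matrix ComplexConjugate Kronecker Matrix.Norms.L2Operator
open Matrix Literature.MathematicalPhysics.QuantumLattice
open Summit.QuantumFields.QCD.Cruxes.CriticalLineDiamagnetism.ChessboardCellGain.FrequencyDiamagnetism
open Summit.QuantumFields.QCD.Cruxes.CriticalLineDiamagnetism.ChessboardCellGain.CellKappa

namespace Summit.QuantumFields.QCD.Cruxes.CriticalLineDiamagnetism.ChessboardCellGain.CellFO

variable {L₁ L₂ : ℕ} [NeZero L₁] [NeZero L₂]

/-! ### Spin blocks of operators on the torus -/

section Blocks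
variable {T : Type} [Fintype T]

omit [NeZero L₁] [NeZero L₂] [Fintype T] in
/-- Blocks are additive. -/
theorem blk_add (A B : Matrix (T × Fin 3 × Fin 4) (T × Fin 3 × Fin 4) ℂ) (z y : T) :
    spinBlock (A + B) z y = spinBlock A z y + spinBlock B z y := by
  ext i j; simp [spinBlock]

omit [NeZero L₁] [NeZero L₂] [Fintype T] in
/-- Blocks of finite sums. -/
theorem blk_sum (A : ℕ → Matrix (T × Fin 3 × Fin 4) (T × Fin 3 × Fin 4) ℂ) (s : Finset ℕ) (z y : T) :
    spinBlock (∑ k ∈ s, A k) z y = ∑ k ∈ s, spinBlock (A k) z y := by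
  ext i j; simp [spinBlock, Matrix.sum_apply]

omit [NeZero L₁] [NeZero L₂] [Fintype T] in
/-- Blocks of `X ⊗ 1 ⊗ S`. -/
theorem blk_kron (X : Matrix T T ℂ) (S : Matrix (Fin 4) (Fin 4) ℂ) (z y : T) :
    spinBlock (X ⊗ₖ ((1 : Matrix (Fin 3) (Fin 3) ℂ) ⊗ₖ S)) z y = X z y • S := by
  ext i j; simp [spinBlock, Matrix.kroneckerMap_apply]

omit [NeZero L₁] [NeZero L₂] in
/-- Blocks of `(X ⊗ 1 ⊗ S) W`: `Σ_{z'} X(z,z') · S · W(z', y)`. -/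
theorem blk_kron_mul (X : Matrix T T ℂ) (S : Matrix (Fin 4) (Fin 4) ℂ)
    (W : Matrix (T × Fin 3 × Fin 4) (T × Fin 3 × Fin 4) ℂ) (z y : T) :
    spinBlock (X ⊗ₖ ((1 : Matrix (Fin 3) (Fin 3) ℂ) ⊗ₖ S) * W) z y = ∑ z' : T, X z z' • (S * spinBlock W z' y) := by
  ext i j
  simp only [spinBlock, Matrix.of_apply, Matrix.mul_apply, Matrix.sum_apply, Matrix.smul_apply, smul_eq_mul,
    Fintype.sum_prod_type, Matrix.kroneckerMap_apply, Matrix.one_apply, Finset.mul_sum]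
  refine Finset.sum_congr rfl fun z' _ => ?_
  rw [Finset.sum_eq_single_of_mem (0 : Fin 3) (Finset.mem_univ _) fun c _ hc => by simp [Ne.symm hc]]
  simp only [if_true, one_mul, mul_assoc]

variable [DecidableEq T]

/-- The block of a big matrix is bounded by its operator norm. -/
theorem norm_blk_le (A : Matrix (T × Fin 3 × Fin 4) (T × Fin 3 × Fin 4) ℂ) (z y : T) : ‖spinBlock A z y‖ ≤ ‖A‖ := by
  set Ez : Matrix (Fin 4) (T × Fin 3 × Fin 4) ℂ := Matrix.of fun i q => if q = (z, 0, i) then 1 else 0 with hEz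
  set Ey : Matrix (T × Fin 3 × Fin 4) (Fin 4) ℂ := Matrix.of fun p j => if p = (y, 0, j) then 1 else 0 with hEy
  have hblk : spinBlock A z y = Ez * A * Ey := by
    ext i j
    simp only [spinBlock, Matrix.of_apply, Matrix.mul_apply, hEz, hEy, mul_ite, mul_one, mul_zero, Finset.sum_ite_eq',
      Finset.mem_univ, if_true]
    rw [Finset.sum_eq_single_of_mem (z, (0 : Fin 3), i) (Finset.mem_univ _) fun q _ hq => by rw [if_neg hq, zero_mul]]
    simp
  have hEz1 : Ezᴴᴴ * Ezᴴ = 1 := by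
    rw [Matrix.conjTranspose_conjTranspose]
    ext i j
    simp only [Matrix.mul_apply, Matrix.conjTranspose_apply, hEz, Matrix.of_apply, Matrix.one_apply]
    rw [Finset.sum_eq_single_of_mem (z, (0 : Fin 3), j) (Finset.mem_univ _) fun q _ hq => by simp [hq]]
    by_cases hij : i = j
    · subst hij; simp
    · simp [hij, Ne.symm hij]
  have hEy1 : Eyᴴ * Ey = 1 := by
    ext i j
    simp only [Matrix.mul_apply, Matrix.conjTranspose_apply, hEy, Matrix.of_apply, Matrix.one_apply]
    rw [Finset.sum_eq_single_of_mem (y, (0 : Fin 3), j) (Finset.mem_univ _) fun q _ hq => by simp [hq]]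
    by_cases hij : i = j
    · subst hij; simp
    · simp [hij, Ne.symm hij]
  have nEz : ‖Ez‖ ≤ 1 := by
    have h : ‖Ezᴴ‖ * ‖Ezᴴ‖ ≤ 1 := by
      rw [← Matrix.l2_opNorm_conjTranspose_mul_self, hEz1, Matrix.cstar_norm_def, map_one]
      exact ContinuousLinearMap.norm_id_le
    rw [Matrix.l2_opNorm_conjTranspose] at h
    nlinarith [norm_nonneg Ez]
  have nEy : ‖Ey‖ ≤ 1 := by
    have h : ‖Ey‖ * ‖Ey‖ ≤ 1 := by
      rw [← Matrix.l2_opNorm_conjTranspose_mul_self, hEy1, Matrix.cstar_norm_def, map_one]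
      exact ContinuousLinearMap.norm_id_le
    nlinarith [norm_nonneg Ey]
  rw [hblk]
  calc ‖Ez * A * Ey‖ ≤ ‖Ez‖ * ‖A‖ * ‖Ey‖ :=
        (Matrix.l2_opNorm_mul _ _).trans (mul_le_mul_of_nonneg_right (Matrix.l2_opNorm_mul _ _) (norm_nonneg _))
    _ ≤ 1 * ‖A‖ * 1 := by gcongr
    _ = ‖A‖ := by ring

end Blocks

/-! ### The torus walk recursion -/

/-- The one-step transition operator `K = N⁻¹H` in Kronecker form. -/
theorem K_eq_kron (m ω₀ ω₁ : ℝ) :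
    (1 : Matrix (ZMod L₁ × ZMod L₂) (ZMod L₁ × ZMod L₂) ℂ) ⊗ₖ ((1 : Matrix (Fin 3) (Fin 3) ℂ) ⊗ₖ
        nInv (m + 4 - Real.cos ω₀ - Real.cos ω₁) (Real.sin ω₀) (Real.sin ω₁)) * hopOp L₁ L₂ =
      sfShift L₁ L₂ ⊗ₖ ((1 : Matrix (Fin 3) (Fin 3) ℂ) ⊗ₖ
          (nInv (m + 4 - Real.cos ω₀ - Real.cos ω₁) (Real.sin ω₀) (Real.sin ω₁) * pMinus 2)) +
        sbShift L₁ L₂ ⊗ₖ ((1 : Matrix (Fin 3) (Fin 3) ℂ) ⊗ₖ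
          (nInv (m + 4 - Real.cos ω₀ - Real.cos ω₁) (Real.sin ω₀) (Real.sin ω₁) * pPlus 2)) +
        ufShift L₁ L₂ ⊗ₖ ((1 : Matrix (Fin 3) (Fin 3) ℂ) ⊗ₖ
          (nInv (m + 4 - Real.cos ω₀ - Real.cos ω₁) (Real.sin ω₀) (Real.sin ω₁) * pMinus 3)) +
        ubShift L₁ L₂ ⊗ₖ ((1 : Matrix (Fin 3) (Fin 3) ℂ) ⊗ₖ
          (nInv (m + 4 - Real.cos ω₀ - Real.cos ω₁) (Real.sin ω₀) (Real.sin ω₁) * pPlus 3)) := by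
  simp only [hopOp, Matrix.mul_add, ← Matrix.mul_kronecker_mul, Matrix.one_mul]

/-- Collapsing a sum against the forward first-coordinate shift. -/
theorem sum_Sf_smul (Φ : ZMod L₁ × ZMod L₂ → Matrix (Fin 4) (Fin 4) ℂ) (z : ZMod L₁ × ZMod L₂) :
    ∑ z', sfShift L₁ L₂ z z' • Φ z' = (if z.1 = -1 then (-1 : ℂ) else 1) • Φ (z.1 + 1, z.2) := by
  simp only [sfShift, Matrix.of_apply, ite_smul, zero_smul, Finset.sum_ite_eq', Finset.mem_univ, if_true]

/-- Collapsing a sum against the backward first-coordinate shift. -/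
theorem sum_Sb_smul (Φ : ZMod L₁ × ZMod L₂ → Matrix (Fin 4) (Fin 4) ℂ) (z : ZMod L₁ × ZMod L₂) :
    ∑ z', sbShift L₁ L₂ z z' • Φ z' = (if z.1 - 1 = -1 then (-1 : ℂ) else 1) • Φ (z.1 - 1, z.2) := by
  have hiff : ∀ y : ZMod L₁ × ZMod L₂, z = (y.1 + 1, y.2) ↔ y = (z.1 - 1, z.2) := fun y =>
    ⟨fun h => by subst h; simp, fun h => by subst h; simp⟩
  simp only [sbShift, Matrix.of_apply, hiff, ite_smul, zero_smul, Finset.sum_ite_eq', Finset.mem_univ, if_true]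

/-- Collapsing a sum against the forward second-coordinate shift. -/
theorem sum_Uf_smul (Φ : ZMod L₁ × ZMod L₂ → Matrix (Fin 4) (Fin 4) ℂ) (z : ZMod L₁ × ZMod L₂) :
    ∑ z', ufShift L₁ L₂ z z' • Φ z' = (if z.2 = -1 then (-1 : ℂ) else 1) • Φ (z.1, z.2 + 1) := by
  simp only [ufShift, Matrix.of_apply, ite_smul, zero_smul, Finset.sum_ite_eq', Finset.mem_univ, if_true]

/-- Collapsing a sum against the backward second-coordinate shift. -/
theorem sum_Ub_smul (Φ : ZMod L₁ × ZMod L₂ → Matrix (Fin 4) (Fin 4) ℂ) (z : ZMod L₁ × ZMod L₂) :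
    ∑ z', ubShift L₁ L₂ z z' • Φ z' = (if z.2 - 1 = -1 then (-1 : ℂ) else 1) • Φ (z.1, z.2 - 1) := by
  have hiff : ∀ y : ZMod L₁ × ZMod L₂, z = (y.1, y.2 + 1) ↔ y = (z.1, z.2 - 1) := fun y =>
    ⟨fun h => by subst h; simp, fun h => by subst h; simp⟩
  simp only [ubShift, Matrix.of_apply, hiff, ite_smul, zero_smul, Finset.sum_ite_eq', Finset.mem_univ, if_true]

/-- **The torus walk recursion**: the blocks of `K W` in terms of the blocks of `W`. -/
theorem blk_K_mul (m ω₀ ω₁ : ℝ)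
    (W : Matrix ((ZMod L₁ × ZMod L₂) × Fin 3 × Fin 4) ((ZMod L₁ × ZMod L₂) × Fin 3 × Fin 4) ℂ)
    (z y : ZMod L₁ × ZMod L₂) :
    spinBlock ((1 : Matrix (ZMod L₁ × ZMod L₂) (ZMod L₁ × ZMod L₂) ℂ) ⊗ₖ ((1 : Matrix (Fin 3) (Fin 3) ℂ) ⊗ₖ
        nInv (m + 4 - Real.cos ω₀ - Real.cos ω₁) (Real.sin ω₀) (Real.sin ω₁)) * hopOp L₁ L₂ * W) z y =
      (if z.1 = -1 then (-1 : ℂ) else 1) •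
          (nInv (m + 4 - Real.cos ω₀ - Real.cos ω₁) (Real.sin ω₀) (Real.sin ω₁) * pMinus 2 * spinBlock W ((z.1 + 1, z.2)) y) +
        (if z.1 - 1 = -1 then (-1 : ℂ) else 1) •
          (nInv (m + 4 - Real.cos ω₀ - Real.cos ω₁) (Real.sin ω₀) (Real.sin ω₁) * pPlus 2 * spinBlock W ((z.1 - 1, z.2)) y) +
        (if z.2 = -1 then (-1 : ℂ) else 1) •
          (nInv (m + 4 - Real.cos ω₀ - Real.cos ω₁) (Real.sin ω₀) (Real.sin ω₁) * pMinus 3 * spinBlock W ((z.1, z.2 + 1)) y) +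
        (if z.2 - 1 = -1 then (-1 : ℂ) else 1) •
          (nInv (m + 4 - Real.cos ω₀ - Real.cos ω₁) (Real.sin ω₀) (Real.sin ω₁) * pPlus 3 * spinBlock W ((z.1, z.2 - 1)) y) := by
  rw [K_eq_kron, Matrix.add_mul, Matrix.add_mul, Matrix.add_mul, blk_add, blk_add, blk_add, blk_kron_mul,
    blk_kron_mul, blk_kron_mul, blk_kron_mul, sum_Sf_smul, sum_Sb_smul, sum_Uf_smul, sum_Ub_smul]

/-! ### The finite Neumann expansion -/

/-- **Finite Neumann expansion** of the free propagator: `G = Σ_{j<J} K^j N⁻¹ + K^J G`. -/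
theorem free_inv_expand {m ω₀ ω₁ : ℝ} (hM : 2 < m + 4 - Real.cos ω₀ - Real.cos ω₁) (J : ℕ) :
    (freeOp L₁ L₂ m ω₀ ω₁)⁻¹ =
      (∑ j ∈ Finset.range J,
        ((1 : Matrix (ZMod L₁ × ZMod L₂) (ZMod L₁ × ZMod L₂) ℂ) ⊗ₖ ((1 : Matrix (Fin 3) (Fin 3) ℂ) ⊗ₖ
          nInv (m + 4 - Real.cos ω₀ - Real.cos ω₁) (Real.sin ω₀) (Real.sin ω₁)) * hopOp L₁ L₂) ^ j *
        ((1 : Matrix (ZMod L₁ × ZMod L₂) (ZMod L₁ × ZMod L₂) ℂ) ⊗ₖ ((1 : Matrix (Fin 3) (Fin 3) ℂ) ⊗ₖ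
          nInv (m + 4 - Real.cos ω₀ - Real.cos ω₁) (Real.sin ω₀) (Real.sin ω₁)))) +
      ((1 : Matrix (ZMod L₁ × ZMod L₂) (ZMod L₁ × ZMod L₂) ℂ) ⊗ₖ ((1 : Matrix (Fin 3) (Fin 3) ℂ) ⊗ₖ
          nInv (m + 4 - Real.cos ω₀ - Real.cos ω₁) (Real.sin ω₀) (Real.sin ω₁)) * hopOp L₁ L₂) ^ J *
        (freeOp L₁ L₂ m ω₀ ω₁)⁻¹ := by
  induction J with
  | zero => simp
  | succ J ih =>
      rw [Finset.sum_range_succ, pow_succ, add_assoc, Matrix.mul_assoc, ← Matrix.mul_add, ← free_inv_eq hM]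
      exact ih

/-! ### Planar identification of the short torus walks -/

omit [NeZero L₁] [NeZero L₂] in
/-- Integers of small absolute value are faithfully represented in `ZMod L`: the test `= 0`. -/
theorem intCast_eq_zero_iff {L : ℕ} {R : ℕ} (hL : R + 1 < L) {u : ℤ} (hu : |u| ≤ R) :
    ((u : ZMod L) = 0) ↔ u = 0 := by
  refine ⟨fun h => ?_, fun h => by simp [h]⟩
  rw [ZMod.intCast_zmod_eq_zero_iff_dvd] at h
  exact Int.eq_zero_of_abs_lt_dvd h (by omega)

omit [NeZero L₁] [NeZero L₂] in
/-- Integers of small absolute value are faithfully represented in `ZMod L`: the test `= −1`. -/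
theorem intCast_eq_neg_one_iff {L : ℕ} {R : ℕ} (hL : R + 1 < L) {u : ℤ} (hu : |u| + 1 ≤ R) :
    ((u : ZMod L) = -1) ↔ u = -1 := by
  have h := intCast_eq_zero_iff (L := L) hL (u := u + 1) (by
    calc |u + 1| ≤ |u| + |1| := abs_add_le _ _
      _ ≤ R := by rw [abs_one]; exact_mod_cast hu)
  push_cast at h
  rw [← eq_neg_iff_add_eq_zero] at h
  rw [h]
  omega

omit [NeZero L₁] [NeZero L₂] in
/-- Gauge identity for a forward step. -/
theorem int_sign_fwd (u : ℤ) :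
    (if u = -1 then (-1 : ℂ) else 1) * (if u + 1 < 0 then (-1 : ℂ) else 1) = (if u < 0 then (-1 : ℂ) else 1) := by
  split_ifs <;> norm_num <;> omega

omit [NeZero L₁] [NeZero L₂] in
/-- Gauge identity for a backward step. -/
theorem int_sign_bwd (u : ℤ) :
    (if u = 0 then (-1 : ℂ) else 1) * (if u - 1 < 0 then (-1 : ℂ) else 1) = (if u < 0 then (-1 : ℂ) else 1) := by
  split_ifs <;> norm_num <;> omega

/-- **Planar identification**: a torus walk sum of length `j` from the origin to a site at planar position `(u, v)` with
`|u| + |v| + j ≤ R`, `R + 1 < L₁, L₂`, equals the planar walk sum up to the gauge sign `ε(u,v) = sgn⁺(u) sgn⁺(v)`. -/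
theorem torusWalk_eq_planar (m ω₀ ω₁ : ℝ) {R : ℕ} (hL₁ : R + 1 < L₁) (hL₂ : R + 1 < L₂) :
    ∀ (j : ℕ) (u v : ℤ), |u| + |v| + j ≤ R →
      spinBlock (((1 : Matrix (ZMod L₁ × ZMod L₂) (ZMod L₁ × ZMod L₂) ℂ) ⊗ₖ ((1 : Matrix (Fin 3) (Fin 3) ℂ) ⊗ₖ
          nInv (m + 4 - Real.cos ω₀ - Real.cos ω₁) (Real.sin ω₀) (Real.sin ω₁)) * hopOp L₁ L₂) ^ j *
        ((1 : Matrix (ZMod L₁ × ZMod L₂) (ZMod L₁ × ZMod L₂) ℂ) ⊗ₖ ((1 : Matrix (Fin 3) (Fin 3) ℂ) ⊗ₖ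
          nInv (m + 4 - Real.cos ω₀ - Real.cos ω₁) (Real.sin ω₀) (Real.sin ω₁)))) ((((u : ZMod L₁)), ((v : ZMod L₂)))) (((0 : ZMod L₁), (0 : ZMod L₂))) =
      ((if u < 0 then (-1 : ℂ) else 1) * (if v < 0 then (-1 : ℂ) else 1)) •
        planarWalk (m + 4 - Real.cos ω₀ - Real.cos ω₁) (Real.sin ω₀) (Real.sin ω₁) j (u, v) := by
  intro j
  induction j with
  | zero =>
      intro u v huv
      have hu : |u| ≤ R := by have := abs_nonneg v; omega
      have hv : |v| ≤ R := by have := abs_nonneg u; omega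
      rw [pow_zero, Matrix.one_mul, blk_kron, planarWalk, Matrix.one_apply]
      simp only [Prod.mk.injEq, intCast_eq_zero_iff hL₁ hu, intCast_eq_zero_iff hL₂ hv]
      by_cases h : u = 0 ∧ v = 0
      · obtain ⟨rfl, rfl⟩ := h
        simp
      · rw [if_neg h, if_neg h, zero_smul, smul_zero]
  | succ j ih =>
      intro u v huv
      have hu : |u| + 1 ≤ R := by have := abs_nonneg v; omega
      have hv : |v| + 1 ≤ R := by have := abs_nonneg u; omega
      have hu' : |u| ≤ R := by omega
      have hv' : |v| ≤ R := by omega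
      have h1 := ih (u + 1) v (by have := abs_add_le u 1; rw [abs_one] at this; omega)
      have h2 := ih (u - 1) v (by have := abs_sub u 1; rw [abs_one] at this; omega)
      have h3 := ih u (v + 1) (by have := abs_add_le v 1; rw [abs_one] at this; omega)
      have h4 := ih u (v - 1) (by have := abs_sub v 1; rw [abs_one] at this; omega)
      push_cast at h1 h2 h3 h4
      rw [pow_succ', Matrix.mul_assoc, blk_K_mul]
      dsimp only
      rw [h1, h2, h3, h4, planarWalk]
      have g1 : (if (u : ZMod L₁) = -1 then (-1 : ℂ) else 1) *
          ((if u + 1 < 0 then (-1 : ℂ) else 1) * (if v < 0 then (-1 : ℂ) else 1)) =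
          (if u < 0 then (-1 : ℂ) else 1) * (if v < 0 then (-1 : ℂ) else 1) := by
        simp only [intCast_eq_neg_one_iff hL₁ hu]
        rw [← mul_assoc, int_sign_fwd]
      have g2 : (if (u : ZMod L₁) - 1 = -1 then (-1 : ℂ) else 1) *
          ((if u - 1 < 0 then (-1 : ℂ) else 1) * (if v < 0 then (-1 : ℂ) else 1)) =
          (if u < 0 then (-1 : ℂ) else 1) * (if v < 0 then (-1 : ℂ) else 1) := by
        have e : ((u : ZMod L₁) - 1 = -1) ↔ ((u : ZMod L₁) = 0) := by
          constructor <;> intro h <;> linear_combination h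
        simp only [e, intCast_eq_zero_iff hL₁ hu']
        rw [← mul_assoc, int_sign_bwd]
      have g3 : (if (v : ZMod L₂) = -1 then (-1 : ℂ) else 1) *
          ((if u < 0 then (-1 : ℂ) else 1) * (if v + 1 < 0 then (-1 : ℂ) else 1)) =
          (if u < 0 then (-1 : ℂ) else 1) * (if v < 0 then (-1 : ℂ) else 1) := by
        simp only [intCast_eq_neg_one_iff hL₂ hv]
        rw [mul_left_comm, int_sign_fwd]
      have g4 : (if (v : ZMod L₂) - 1 = -1 then (-1 : ℂ) else 1) *
          ((if u < 0 then (-1 : ℂ) else 1) * (if v - 1 < 0 then (-1 : ℂ) else 1)) =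
          (if u < 0 then (-1 : ℂ) else 1) * (if v < 0 then (-1 : ℂ) else 1) := by
        have e : ((v : ZMod L₂) - 1 = -1) ↔ ((v : ZMod L₂) = 0) := by
          constructor <;> intro h <;> linear_combination h
        simp only [e, intCast_eq_zero_iff hL₂ hv']
        rw [mul_left_comm, int_sign_bwd]
      simp only [steps, List.map_cons, List.map_nil, List.sum_cons, List.sum_nil, add_zero, ← sub_eq_add_neg,
        Matrix.mul_smul, smul_smul, Matrix.mul_add, Matrix.mul_assoc, smul_add]
      rw [g1, g2, g3, g4]
      abel

/-! ### The reference link block is close to the truncated planar propagator -/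

omit [NeZero L₁] [NeZero L₂] in
/-- A `List.range` sum is a `Finset.range` sum. -/
theorem list_range_map_sum {α : Type} [AddCommMonoid α] (f : ℕ → α) (n : ℕ) :
    ((List.range n).map f).sum = ∑ j ∈ Finset.range n, f j := by
  induction n with
  | zero => simp
  | succ n ih => rw [List.range_succ, List.map_append, List.sum_append, ih, Finset.sum_range_succ]; simp

/-- **The reference link block of the free torus propagator is within `2.5·10⁻⁷` of the planar propagator truncated at
walk length `14`** (heavy box `M_ω ≥ 5.89`, torus lengths `≥ 17` so that walks of length `≤ 14` between `(0,0)` and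
`(1,0)` do not wrap; the tail is `‖K^15 G‖ ≤ (2/M)^15/(M − 2)`). -/
theorem free_inv_block_near_planar {m ω₀ ω₁ : ℝ} (hM : 589 / 100 ≤ m + 4 - Real.cos ω₀ - Real.cos ω₁)
    (hL₁ : 17 ≤ L₁) (hL₂ : 17 ≤ L₂) :
    ‖spinBlock ((freeOp L₁ L₂ m ω₀ ω₁)⁻¹) (((1 : ZMod L₁), (0 : ZMod L₂))) (((0 : ZMod L₁), (0 : ZMod L₂))) -
        propTrunc (m + 4 - Real.cos ω₀ - Real.cos ω₁) (Real.sin ω₀) (Real.sin ω₁) 14 (1, 0)‖ ≤ 1 / (4 * 10 ^ 6) := by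
  have hM2 : 2 < m + 4 - Real.cos ω₀ - Real.cos ω₁ := by linarith
  have hM0 : 0 < m + 4 - Real.cos ω₀ - Real.cos ω₁ := by linarith
  have hexp := free_inv_expand (L₁ := L₁) (L₂ := L₂) hM2 (14 + 1)
  have hblk : spinBlock ((freeOp L₁ L₂ m ω₀ ω₁)⁻¹) (((1 : ZMod L₁), (0 : ZMod L₂))) (((0 : ZMod L₁), (0 : ZMod L₂))) =
      (∑ j ∈ Finset.range (14 + 1),
        spinBlock (((1 : Matrix (ZMod L₁ × ZMod L₂) (ZMod L₁ × ZMod L₂) ℂ) ⊗ₖ ((1 : Matrix (Fin 3) (Fin 3) ℂ) ⊗ₖ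
          nInv (m + 4 - Real.cos ω₀ - Real.cos ω₁) (Real.sin ω₀) (Real.sin ω₁)) * hopOp L₁ L₂) ^ j *
        ((1 : Matrix (ZMod L₁ × ZMod L₂) (ZMod L₁ × ZMod L₂) ℂ) ⊗ₖ ((1 : Matrix (Fin 3) (Fin 3) ℂ) ⊗ₖ
          nInv (m + 4 - Real.cos ω₀ - Real.cos ω₁) (Real.sin ω₀) (Real.sin ω₁)))) (((1 : ZMod L₁), (0 : ZMod L₂))) (((0 : ZMod L₁), (0 : ZMod L₂)))) +
      spinBlock (((1 : Matrix (ZMod L₁ × ZMod L₂) (ZMod L₁ × ZMod L₂) ℂ) ⊗ₖ ((1 : Matrix (Fin 3) (Fin 3) ℂ) ⊗ₖ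
          nInv (m + 4 - Real.cos ω₀ - Real.cos ω₁) (Real.sin ω₀) (Real.sin ω₁)) * hopOp L₁ L₂) ^ (14 + 1) *
        (freeOp L₁ L₂ m ω₀ ω₁)⁻¹) (((1 : ZMod L₁), (0 : ZMod L₂))) (((0 : ZMod L₁), (0 : ZMod L₂))) := by
    nth_rw 1 [hexp]
    rw [blk_add, blk_sum]
  have hsum : (∑ j ∈ Finset.range (14 + 1),
        spinBlock (((1 : Matrix (ZMod L₁ × ZMod L₂) (ZMod L₁ × ZMod L₂) ℂ) ⊗ₖ ((1 : Matrix (Fin 3) (Fin 3) ℂ) ⊗ₖ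
          nInv (m + 4 - Real.cos ω₀ - Real.cos ω₁) (Real.sin ω₀) (Real.sin ω₁)) * hopOp L₁ L₂) ^ j *
        ((1 : Matrix (ZMod L₁ × ZMod L₂) (ZMod L₁ × ZMod L₂) ℂ) ⊗ₖ ((1 : Matrix (Fin 3) (Fin 3) ℂ) ⊗ₖ
          nInv (m + 4 - Real.cos ω₀ - Real.cos ω₁) (Real.sin ω₀) (Real.sin ω₁)))) (((1 : ZMod L₁), (0 : ZMod L₂))) (((0 : ZMod L₁), (0 : ZMod L₂)))) =
      propTrunc (m + 4 - Real.cos ω₀ - Real.cos ω₁) (Real.sin ω₀) (Real.sin ω₁) 14 (1, 0) := by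
    rw [propTrunc, list_range_map_sum]
    refine Finset.sum_congr rfl fun j hj => ?_
    have hj' : j ≤ 14 := by simpa [Nat.lt_succ_iff] using Finset.mem_range.mp hj
    have h := torusWalk_eq_planar (L₁ := L₁) (L₂ := L₂) m ω₀ ω₁ (R := 15) (by omega) (by omega) j 1 0
      (by norm_num; omega)
    simp only [Int.cast_one, Int.cast_zero] at h
    rw [h]
    norm_num
  rw [hblk, hsum, add_sub_cancel_left]
  calc _ ≤ _ := norm_blk_le _ _ _
    _ ≤ ‖(1 : Matrix (ZMod L₁ × ZMod L₂) (ZMod L₁ × ZMod L₂) ℂ) ⊗ₖ ((1 : Matrix (Fin 3) (Fin 3) ℂ) ⊗ₖ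
          nInv (m + 4 - Real.cos ω₀ - Real.cos ω₁) (Real.sin ω₀) (Real.sin ω₁)) * hopOp L₁ L₂‖ ^ (14 + 1) *
          ‖(freeOp L₁ L₂ m ω₀ ω₁)⁻¹‖ :=
        (Matrix.l2_opNorm_mul _ _).trans (mul_le_mul_of_nonneg_right (norm_pow_le _ _) (norm_nonneg _))
    _ ≤ (2 / (m + 4 - Real.cos ω₀ - Real.cos ω₁)) ^ (14 + 1) * (1 / (m + 4 - Real.cos ω₀ - Real.cos ω₁ - 2)) :=
        mul_le_mul (pow_le_pow_left₀ (norm_nonneg _) (norm_K_le hM0) _) (norm_free_inv_le hM2) (norm_nonneg _)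
          (by positivity)
    _ ≤ (200 / 589 : ℝ) ^ (14 + 1) * (100 / 389) := by
        have h1 : 2 / (m + 4 - Real.cos ω₀ - Real.cos ω₁) ≤ 200 / 589 := by
          rw [div_le_div_iff₀ hM0 (by norm_num)]; linarith
        have h2 : 1 / (m + 4 - Real.cos ω₀ - Real.cos ω₁ - 2) ≤ 100 / 389 := by
          rw [div_le_div_iff₀ (by linarith) (by norm_num)]; linarith
        exact mul_le_mul (pow_le_pow_left₀ (by positivity) h1 _) h2 (by positivity) (by positivity)
    _ ≤ 1 / (4 * 10 ^ 6) := by norm_num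

end CellFO

/-- **Registered anchor `cellFreePlanarBlock`**: the reference link block of the free torus propagator is within `1/(4·10⁶)` of the planar propagator truncated at walk length `14`. -/
theorem cellFreePlanarBlock : ∀ (L₁ L₂ : ℕ) [NeZero L₁] [NeZero L₂] (m ω₀ ω₁ : ℝ), 589 / 100 ≤ m + 4 - Real.cos ω₀ - Real.cos ω₁ → 17 ≤ L₁ → 17 ≤ L₂ → ‖CellFO.spinBlock (CellFO.freeOp L₁ L₂ m ω₀ ω₁)⁻¹ ((1 : ZMod L₁), (0 : ZMod L₂)) ((0 : ZMod L₁), (0 : ZMod L₂)) - CellKappa.propTrunc (m + 4 - Real.cos ω₀ - Real.cos ω₁) (Real.sin ω₀) (Real.sin ω₁) 14 (1, 0)‖ ≤ 1 / (4 * 10 ^ 6) :=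
  fun _ _ _ _ _ _ _ hM h1 h2 => CellFO.free_inv_block_near_planar hM h1 h2

end Summit.QuantumFields.QCD.Cruxes.CriticalLineDiamagnetism.ChessboardCellGain

end
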